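import Summits.ResolutionOfSingularities.ResolutionOfSingularities.Theorems.UniversalCellsCampaignW82PerfectionDescent
import Summits.ResolutionOfSingularities.ResolutionOfSingularities.Theorems.UniversalCellsCampaignW82FamilyTransferCore
import Summits.ResolutionOfSingularities.ResolutionOfSingularities.Theorems.UniversalCellsCampaignW82SmoothTwistGraded
import HarnessLib

/-!
# [OURS · L1 W8.2] Links for the reversible perfection step: resolution over `M(t)^{perf}` descends to `M` AND
# to `M(t)`; the door-1 tower is monotone; the residual is squeezed between consecutive grades over `M(t)^{perf}`

Cell `res-hironaka` (run/shared/lean/pub/res-hironaka/), LADDER-RESOLUTION rung L (RESCUE), slot W8.2; host route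
`UniversalCells`, host item `PrimeFieldToPerfect` (stmt-ResolutionOfSingularities-15233), door 1. Proofs file
(Theses-free), written by res-L1-s82-pv-1 (gen 4): by-name corollaries of `…PerfectionDescent.lean`
(`integralResUpToDim_of_isPurelyInseparable_ratFunc`: for an infinite perfect `M` of characteristic `p` and a
perfect `L ⊇ M(t)` purely inseparable over `M(t)`, `Res_{≤ n}(L) ⇒ Res_{≤ n}(M)`), in the binder shape of the
slot's residual `CampaignW82.PerfectionStepAt M n` / kernel `CampaignW82.ClimbRatFuncPerf p` (the `M`-algebra
structure on `L` is the composite through `RatFunc M`, as there).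

* §1 `integralRes_of_perfect_purelyInseparable_ratFunc` (all dimensions) and its graded form — the INVERSE of the
  kernel's climb `Res(M) ⇒ Res(L)`, binder for binder;
* §2 **`integralRes_ratFunc_of_perfectClosure`** — RESOLUTION DESCENDS ALONG THE PERFECT CLOSURE OF `M(t)`:
  `Res(L) ⇒ Res(RatFunc M)` (via `M` and the family transfer `integralRes_of_isFractionRing`, gen 0); graded:
  `Res_{≤ n+1}(L) ⇒ Res_{≤ n}(RatFunc M)` (`integralResolutionOverUpToDim_ratFunc_of_perfectClosure`). So the
  HYPOTHESIS of the residual `PerfectionStepAt M n` follows from its CONCLUSION one grade up: over the single field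
  `Λ = M(t)^{perf}` the residual at grade `n` is squeezed as `Res_{≤ n+1}(Λ) ⇒ Res_{≤ n}(M(t)) ⇒[residual] Res_{≤ n}(Λ)`
  (`perfectionStepAt_hyp_of_succ`);
* §3 **`integralRes_tower_mono`** — THE DOOR-1 TOWER IS MONOTONE: for perfect `M`, `L₁ ⊇ M(t)` and `L₂ ⊇ L₁(t)`
  perfect purely inseparable, `Res(L₂) ⇒ Res(L₁)` (no hypothesis on `M`: `L₁ ⊇ M[t]` is infinite); along the climb
  `𝔽_p ⊂ M₁ ⊂ M₂ ⊂ ⋯`, `M_{d+1} = M_d(t)^{perf}`, the statements `Res(M_d)`, `d ≥ 1`, INCREASE in strength with `d`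
  — the door-1 companion of res-L1-s82-pv-2's door-2 monotonicity (`PrimeModelTransfer.integralResOver_subfield_of_integralResOver_subfield`).

HONEST FRAMING. OURS theorems about OURS statements (role replaced: §17 ¶2 p.89 l.59–62 of [Hironaka2017], typed AS
PRINTED as `S17Methodology.U89_3`); NOT statements of the manuscript; nothing attributed to its author; no typed
candidate used. The open UPWARD step (`PerfectionStepAt M n`, `n ≥ 4`) is untouched. AI work, weaker than expert
review; no claim beyond the kernel.
-/

noncomputable section

set_option linter.dupNamespace false -- mandated namespace of this single-conjunct summit

open CategoryTheory CategoryTheory.Limits AlgebraicGeometry TopologicalSpace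
open Literature.AlgebraicGeometry.Resolution

namespace Summit.ResolutionOfSingularities.ResolutionOfSingularities.Theorems.CampaignW82

/-- `RatFunc M` is infinite (it contains `M[t]`). [folklore] -/
theorem infinite_ratFunc (M : Type) [Field M] : Infinite (RatFunc M) :=
  Infinite.of_injective _ (IsFractionRing.injective (Polynomial M) (RatFunc M))

/-- A field receiving `RatFunc M` is infinite. [folklore] -/
theorem infinite_of_algebra_ratFunc (M L : Type) [Field M] [Field L] [Algebra (RatFunc M) L] : Infinite L :=
  haveI := infinite_ratFunc M
  Infinite.of_injective _ (algebraMap (RatFunc M) L).injective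

/-! ## §1 The inverse climb, in the kernel's binder shape -/

/-- **The inverse of the kernel's climb, all dimensions** — binder for binder the converse of one instance of
`CampaignW82.ClimbRatFuncPerf p` at an INFINITE perfect `M`: for `L` perfect and purely inseparable over
`RatFunc M` (its `M`-structure the composite one), resolution of all integral separated schemes of finite type
over `L` implies the same over `M`. [cite: EGAIV3, Thm. 8.10.5] -/
theorem integralRes_of_perfect_purelyInseparable_ratFunc (p : ℕ) [Fact p.Prime] (M : Type) [Field M]
    [CharP M p] [PerfectField M] [Infinite M] (L : Type) [Field L] [PerfectField L] [Algebra (RatFunc M) L]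
    [IsPurelyInseparable (RatFunc M) L]
    (hL : ∀ (X : Scheme.{0}) (f : X ⟶ Spec (.of L)), IsSeparated f → LocallyOfFiniteType f →
      QuasiCompact f → IsIntegral X → Scheme.HasResolution X)
    (X : Scheme.{0}) (f : X ⟶ Spec (.of M)) (hs : IsSeparated f) (hl : LocallyOfFiniteType f)
    (hq : QuasiCompact f) (hX : IsIntegral X) : Scheme.HasResolution X := by
  letI : Algebra M L := ((algebraMap (RatFunc M) L).comp (algebraMap M (RatFunc M))).toAlgebra
  haveI : IsScalarTower M (RatFunc M) L := IsScalarTower.of_algebraMap_eq fun _ => rfl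
  exact integralRes_of_isPurelyInseparable_ratFunc p M L hL X f hs hl hq hX

/-- **The inverse climb, graded by dimension** (`n : WithBot ℕ∞`), same binder shape. [cite: EGAIV3, Thm. 8.10.5] -/
theorem integralResUpToDim_of_perfect_purelyInseparable_ratFunc (p : ℕ) [Fact p.Prime] (M : Type) [Field M]
    [CharP M p] [PerfectField M] [Infinite M] (L : Type) [Field L] [PerfectField L] [Algebra (RatFunc M) L]
    [IsPurelyInseparable (RatFunc M) L] (n : WithBot ℕ∞)
    (hL : ∀ (X : Scheme.{0}) (f : X ⟶ Spec (.of L)), IsSeparated f → LocallyOfFiniteType f →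
      QuasiCompact f → IsIntegral X → topologicalKrullDim X ≤ n → Scheme.HasResolution X)
    (X : Scheme.{0}) (f : X ⟶ Spec (.of M)) (hs : IsSeparated f) (hl : LocallyOfFiniteType f)
    (hq : QuasiCompact f) (hX : IsIntegral X) (hdim : topologicalKrullDim X ≤ n) : Scheme.HasResolution X := by
  letI : Algebra M L := ((algebraMap (RatFunc M) L).comp (algebraMap M (RatFunc M))).toAlgebra
  haveI : IsScalarTower M (RatFunc M) L := IsScalarTower.of_algebraMap_eq fun _ => rfl
  exact integralResUpToDim_of_isPurelyInseparable_ratFunc p M L n hL X f hs hl hq hX hdim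

/-! ## §2 Resolution descends along the perfect closure of `M(t)` -/

/-- **RESOLUTION DESCENDS ALONG THE PERFECT CLOSURE OF `M(t)`**: for an infinite perfect `M` of characteristic
`p` and a perfect `L` purely inseparable over `RatFunc M` (so `L ≅ M(t)^{perf}`), resolution of all integral
separated schemes of finite type over `L` implies the same over `RatFunc M` ITSELF — the imperfect field in
between. Route: `L ⇒ M` (`integralRes_of_perfect_purelyInseparable_ratFunc`) `⇒ RatFunc M` (the family transfer
of gen 0, `integralRes_of_isFractionRing` with `A = M[t]`). Existence of resolutions thus descends along the
inseparable extension `M(t) ⊂ M(t)^{perf}` although no single resolution is base-changed along it (barrier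
`InseparableBaseChangeResolution`). [cite: EGAIV3, Thm. 8.10.5] -/
theorem integralRes_ratFunc_of_perfectClosure (p : ℕ) [Fact p.Prime] (M : Type) [Field M] [CharP M p]
    [PerfectField M] [Infinite M] (L : Type) [Field L] [PerfectField L] [Algebra (RatFunc M) L]
    [IsPurelyInseparable (RatFunc M) L]
    (hL : ∀ (X : Scheme.{0}) (f : X ⟶ Spec (.of L)), IsSeparated f → LocallyOfFiniteType f →
      QuasiCompact f → IsIntegral X → Scheme.HasResolution X)
    (X : Scheme.{0}) (f : X ⟶ Spec (.of (RatFunc M))) (hs : IsSeparated f) (hl : LocallyOfFiniteType f)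
    (hq : QuasiCompact f) (hX : IsIntegral X) : Scheme.HasResolution X := by
  haveI := hs; haveI := hl; haveI := hq; haveI := hX
  exact integralRes_of_isFractionRing (k := M) (Polynomial M) (RatFunc M)
    (integralRes_of_perfect_purelyInseparable_ratFunc p M L hL) X f

/-- **Graded descent along the perfect closure of `M(t)`** (ℕ-graded, tree name `IntegralResolutionOverUpToDim`):
`IntegralResolutionOverUpToDim L (n + 1) → IntegralResolutionOverUpToDim (RatFunc M) n` — one dimension is spent
on the total space over `M[t]` (`integralResolutionOverUpToDim_ratFunc`, gen 0). [cite: EGAIV3, Thm. 8.10.5] -/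
theorem integralResolutionOverUpToDim_ratFunc_of_perfectClosure (p : ℕ) [Fact p.Prime] (M : Type) [Field M]
    [CharP M p] [PerfectField M] [Infinite M] (L : Type) [Field L] [PerfectField L] [Algebra (RatFunc M) L]
    [IsPurelyInseparable (RatFunc M) L] (n : ℕ) (hL : IntegralResolutionOverUpToDim.{0} L (n + 1)) :
    IntegralResolutionOverUpToDim.{0} (RatFunc M) n := by
  letI : Algebra M L := ((algebraMap (RatFunc M) L).comp (algebraMap M (RatFunc M))).toAlgebra
  haveI : IsScalarTower M (RatFunc M) L := IsScalarTower.of_algebraMap_eq fun _ => rfl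
  exact integralResolutionOverUpToDim_ratFunc
    (integralResolutionOverUpToDim_of_isPurelyInseparable_ratFunc p M L (n + 1) hL)

/-- **The residual is squeezed between consecutive grades over `M(t)^{perf}`**: the HYPOTHESIS block of
`PerfectionStepAt M n` (resolution in dimension `≤ n` over `RatFunc M`) follows from resolution in dimension
`≤ n + 1` over any perfect `L ⊇ M(t)` purely inseparable over it — i.e. from the residual's own CONCLUSION one
grade up (`M` infinite perfect, `n : ℕ`). With the residual itself: `Res_{≤ n+1}(Λ) ⇒ Res_{≤ n}(M(t)) ⇒ Res_{≤ n}(Λ)`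
for `Λ = M(t)^{perf}`. [cite: EGAIV3, Thm. 8.10.5] -/
theorem perfectionStepAt_hyp_of_succ (p : ℕ) [Fact p.Prime] (M : Type) [Field M] [CharP M p] [PerfectField M]
    [Infinite M] (L : Type) [Field L] [PerfectField L] [Algebra (RatFunc M) L] [IsPurelyInseparable (RatFunc M) L]
    (n : ℕ)
    (hL : ∀ (X : Scheme.{0}) (f : X ⟶ Spec (.of L)), IsSeparated f → LocallyOfFiniteType f →
      QuasiCompact f → IsIntegral X → topologicalKrullDim X ≤ (n + 1 : ℕ) → Scheme.HasResolution X) :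
    ∀ (X : Scheme.{0}) (f : X ⟶ Spec (.of (RatFunc M))),
      IsSeparated f → LocallyOfFiniteType f → QuasiCompact f → IsIntegral X →
        topologicalKrullDim X ≤ (n : ℕ) → Scheme.HasResolution X :=
  integralResolutionOverUpToDim_ratFunc_of_perfectClosure p M L n hL

/-! ## §3 The door-1 tower is monotone -/

/-- **THE DOOR-1 TOWER IS MONOTONE.** Let `M` be a perfect field of characteristic `p`, `L₁` a perfect field purely
inseparable over `RatFunc M` (so `L₁ ≅ M(t₁)^{perf}`), and `L₂` a perfect field purely inseparable over `RatFunc L₁`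
(`L₂ ≅ L₁(t₂)^{perf}`). Then resolution of all integral separated schemes of finite type over `L₂` implies the same
over `L₁` (`L₁` is infinite — it contains `M[t₁]` — so the inverse climb applies; no hypothesis on `M`). Along
the climb `𝔽_p ⊂ M₁ ⊂ M₂ ⊂ ⋯` of Cruxes/PrimeFieldToPerfect (`M_{d+1} = M_d(t)^{perf}`): `Res(M_{d+1}) ⇒ Res(M_d)`
for every `d ≥ 1`, i.e. the door-1 residual rungs increase in strength with `d`. [cite: EGAIV3, Thm. 8.10.5] -/
theorem integralRes_tower_mono (p : ℕ) [Fact p.Prime] (M : Type) [Field M] [CharP M p] [PerfectField M]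
    (L₁ : Type) [Field L₁] [PerfectField L₁] [Algebra (RatFunc M) L₁] [IsPurelyInseparable (RatFunc M) L₁]
    (L₂ : Type) [Field L₂] [PerfectField L₂] [Algebra (RatFunc L₁) L₂] [IsPurelyInseparable (RatFunc L₁) L₂]
    (h₂ : ∀ (X : Scheme.{0}) (f : X ⟶ Spec (.of L₂)), IsSeparated f → LocallyOfFiniteType f →
      QuasiCompact f → IsIntegral X → Scheme.HasResolution X)
    (X : Scheme.{0}) (f : X ⟶ Spec (.of L₁)) (hs : IsSeparated f) (hl : LocallyOfFiniteType f)
    (hq : QuasiCompact f) (hX : IsIntegral X) : Scheme.HasResolution X := by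
  haveI : CharP L₁ p := charP_of_injective_algebraMap (algebraMap (RatFunc M) L₁).injective p
  haveI : Infinite L₁ := infinite_of_algebra_ratFunc M L₁
  exact integralRes_of_perfect_purelyInseparable_ratFunc p L₁ L₂ h₂ X f hs hl hq hX

/-- **Graded monotonicity of the tower** (`n : WithBot ℕ∞`): `Res_{≤ n}(L₂) ⇒ Res_{≤ n}(L₁)` in the situation
of `integralRes_tower_mono`. [cite: EGAIV3, Thm. 8.10.5] -/
theorem integralResUpToDim_tower_mono (p : ℕ) [Fact p.Prime] (M : Type) [Field M] [CharP M p] [PerfectField M]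
    (L₁ : Type) [Field L₁] [PerfectField L₁] [Algebra (RatFunc M) L₁] [IsPurelyInseparable (RatFunc M) L₁]
    (L₂ : Type) [Field L₂] [PerfectField L₂] [Algebra (RatFunc L₁) L₂] [IsPurelyInseparable (RatFunc L₁) L₂]
    (n : WithBot ℕ∞)
    (h₂ : ∀ (X : Scheme.{0}) (f : X ⟶ Spec (.of L₂)), IsSeparated f → LocallyOfFiniteType f →
      QuasiCompact f → IsIntegral X → topologicalKrullDim X ≤ n → Scheme.HasResolution X)
    (X : Scheme.{0}) (f : X ⟶ Spec (.of L₁)) (hs : IsSeparated f) (hl : LocallyOfFiniteType f)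
    (hq : QuasiCompact f) (hX : IsIntegral X) (hdim : topologicalKrullDim X ≤ n) : Scheme.HasResolution X := by
  haveI : CharP L₁ p := charP_of_injective_algebraMap (algebraMap (RatFunc M) L₁).injective p
  haveI : Infinite L₁ := infinite_of_algebra_ratFunc M L₁
  exact integralResUpToDim_of_perfect_purelyInseparable_ratFunc p L₁ L₂ n h₂ X f hs hl hq hX hdim

end Summit.ResolutionOfSingularities.ResolutionOfSingularities.Theorems.CampaignW82

end
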